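import Summits.ValiantsHypothesis.ValiantsHypothesis.Theorems.GrenetZeonDualUnipotentThreeHalvesLongMassLedgerTorusInitial

/-!
# PARTS II (torus equivariance, basics) + III (curve closure) — Theorems-side port of val-idea-28 g5's staged `…LongMassLedgerTorus.lean` (sha16 98392e2975984a00, 1360 l., 84 decls;
# itself the verbatim Part I/II-basics/III/IV/V/VI/VII extract of the crux workfile `Cruxes/DualUnipotentThreeHalves/InitialForm.lean` rev 14;
# crit-7 g3 V40 δ-READ ✓ of rev 13, STAGE REQUEST; desk val-lit RULINGS #389/#391/#392 «LedgerTorus claim protocol»; hand val-port-3 g3 «CLAIM LedgerTorus» 00:52Z)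

PORT NOTE.  Decl texts VERBATIM BY NAME; namespaces as staged (`…Theorems.GrenetZeon.InitialForm.*`); the ONLY changes are one-line docstrings on helper lemmas the gate's `lint.docstring` requires (marked «docstring added in the port»), the 400-line-cap SPLIT into five
chained modules `GrenetZeonDualUnipotentThreeHalvesLongMassLedgerTorus{Initial, Curve, SlowCurve, Slow, ∅}.lean` (this file imports `GrenetZeonDualUnipotentThreeHalvesLongMassLedgerTorusInitial`) and these headers; `--supports stmt-ValiantsHypothesis-24318`
helper.  ALL CREDIT: val-idea-28 g5 (lens «degeneration – orbit-closure»).  HONEST STATUS (author's, verbatim in spirit): an INSTRUMENT — the normal form of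
(c)-certificates under a torus symmetry; proves NO case of (c) `SlowCore.LongMassSlowLawInv`, is NOT progress on (c); crux 24318 OPEN; VP ≠ VNP is NOT proved.
The author's full module docstring is reproduced in `GrenetZeonDualUnipotentThreeHalvesLongMassLedgerTorusInitial.lean`.
-/

set_option linter.dupNamespace false

/-! # PART II (basics) — torus equivariance of an affine pencil -/

noncomputable section

namespace Summit.ValiantsHypothesis.ValiantsHypothesis.Theorems.GrenetZeon.InitialForm.TorusClosure

open MvPolynomial Matrix
open Summit.ValiantsHypothesis.ValiantsHypothesis.Cruxes.TwoDimCoefficients.DimTwoCases (AffMat IsAffine)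

variable {m n : ℕ}

/-- `map_eval_map_C` — helper of this port (see the module docstring for its role). (docstring added in the port) -/
theorem map_eval_map_C (A : Matrix (Fin m) (Fin m) ℂ) (v : Fin n × Fin n → ℂ) :
    (A.map (C : ℂ → MvPolynomial (Fin n × Fin n) ℂ)).map (MvPolynomial.eval v) = A := by
  ext i j; simp

/-- TORUS EQUIVARIANCE of the pencil under `λ_w`, UP TO A NONZERO SCALAR: `N(λ_w(τ) x) = a_τ · D_τ · N(x) · D_τ'` with `D D' = D' D = 1`,
`a_τ ≠ 0`, for every `τ ≠ 0`.  (The scalar lets a LINEAR pencil absorb a uniform shift of the weights, so that a generic cocharacter of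
ANY torus normalising the pencil — weights of both signs — is covered after shifting to `ℕ`-weights: `torusEquivariant_linPencil`.) -/
def TorusEquivariant (N : AffMat n m) (w : Fin n × Fin n → ℕ) : Prop :=
  ∀ τ : ℂ, τ ≠ 0 → ∃ (a : ℂ) (D D' : Matrix (Fin m) (Fin m) ℂ), a ≠ 0 ∧ D * D' = 1 ∧ D' * D = 1 ∧
    ∀ x, N.map (MvPolynomial.eval (torusAct w τ x)) = a • (D * N.map (MvPolynomial.eval x) * D')

/-- `torusAct_zero` — helper of this port (see the module docstring for its role). (docstring added in the port) -/
theorem torusAct_zero (w : Fin n × Fin n → ℕ) (τ : ℂ) : torusAct w τ (0 : Fin n × Fin n → ℂ) = 0 := by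
  funext e; simp [torusAct]

/-- `torusAct_inv_cancel` — helper of this port (see the module docstring for its role). (docstring added in the port) -/
theorem torusAct_inv_cancel (w : Fin n × Fin n → ℕ) {τ : ℂ} (hτ : τ ≠ 0) (x : Fin n × Fin n → ℂ) :
    torusAct w τ (torusAct w τ⁻¹ x) = x := by
  funext e
  simp only [torusAct]
  rw [← mul_assoc, ← mul_pow, mul_inv_cancel₀ hτ, one_pow, one_mul]

end Summit.ValiantsHypothesis.ValiantsHypothesis.Theorems.GrenetZeon.InitialForm.TorusClosure

end

/-! # PART III — CURVE CLOSURE: the `t`-adic initial subspace of an ALGEBRAIC family of certificates (Mathlib only)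

The torus orbit `λ_w(τ) • K` of Part I is the simplest algebraic one-parameter family of subspaces.  For the DEFORMATION CUT
(crit-7 V28 §3; idea-26 `MassCut.lean` §6 `SlowClosedAlongCurves`, `DeformationCut`) one needs the same step along an arbitrary
POLYNOMIAL CURVE: `exists_limit_of_algebraic_family` — if a `𝕜[X]`-submodule `N ≤ (ι → 𝕜[X])` (an algebraic family of certificate
vectors, `K_t ⊇ ev t N`) evaluates into the zero locus of a family `𝓕 ⊆ MvPolynomial ι 𝕜[X]` (coefficients polynomial in the
parameter) for every `t` in an infinite set `T ∌ 0`, then a `𝕜`-subspace `K₀` with `finrank 𝕜 K₀ = finrank 𝕜[X] N` (= the generic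
dimension), made of initial vectors `u(0)` (`X^C u ∈ N`), lies in the zero locus of `𝓕` at `t = 0`.  Tools: Smith normal form over the
PID `𝕜[X]` (`Submodule.smithNormalForm`), `a i = X^{c i} g i` with `g i (0) ≠ 0`, invertibility of the evaluated basis matrix, and
`Polynomial.eq_zero_of_infinite_isRoot`.  WHAT THIS DOES NOT DO (honest): the POINTWISE `SlowClosedAlongCurves` (certificates `K_t`
chosen independently for each `t`) needs CURVE SELECTION (Chevalley / a finite base change) or properness of the Grassmannian BEFORE this
step — tier L, not here; for CANONICALLY certified laws (`K_t = ker Φ(N_t)` with `Φ` polynomial in the pencil) the kernel over `𝕜[X]`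
is such an `N` on the cofinite set of maximal rank, and this theorem then gives (Cl) outright. -/

section CurveClosure

open scoped Polynomial

namespace Summit.ValiantsHypothesis.ValiantsHypothesis.Theorems.GrenetZeon.InitialForm.CurveClosure

variable {𝕜 : Type*} [Field 𝕜] {ι : Type*}

/-- Evaluation of a polynomial vector at the parameter `t`. -/
def ev (t : 𝕜) (p : ι → 𝕜[X]) : ι → 𝕜 := fun e => (p e).eval t

/-- `ev_apply` — helper of this port (see the module docstring for its role). (docstring added in the port) -/
@[simp] theorem ev_apply (t : 𝕜) (p : ι → 𝕜[X]) (e : ι) : ev t p e = (p e).eval t := rfl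

/-- `ev_add` — helper of this port (see the module docstring for its role). (docstring added in the port) -/
theorem ev_add (t : 𝕜) (p q : ι → 𝕜[X]) : ev t (p + q) = ev t p + ev t q := by
  funext e; simp [ev]

/-- `ev_smul` — helper of this port (see the module docstring for its role). (docstring added in the port) -/
theorem ev_smul (t : 𝕜) (μ : 𝕜) (p : ι → 𝕜[X]) : ev t (μ • p) = μ • ev t p := by
  funext e; simp [ev, Polynomial.eval_smul]

/-- `ev_smul_poly` — helper of this port (see the module docstring for its role). (docstring added in the port) -/
theorem ev_smul_poly (t : 𝕜) (g : 𝕜[X]) (p : ι → 𝕜[X]) : ev t (g • p) = g.eval t • ev t p := by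
  funext e; simp [ev, Polynomial.eval_mul]

/-- `ev_sum` — helper of this port (see the module docstring for its role). (docstring added in the port) -/
theorem ev_sum {α : Type*} (t : 𝕜) (s : Finset α) (p : α → ι → 𝕜[X]) :
    ev t (∑ a ∈ s, p a) = ∑ a ∈ s, ev t (p a) := by
  funext e; simp [ev, Finset.sum_apply, Polynomial.eval_finsetSum]

/-- Compatibility of `MvPolynomial.eval` at a polynomial vector with evaluation of the parameter. -/
theorem eval_ev (t : 𝕜) (u : ι → 𝕜[X]) (F : MvPolynomial ι 𝕜[X]) :
    (MvPolynomial.eval u F).eval t = MvPolynomial.eval (ev t u) (MvPolynomial.map (Polynomial.evalRingHom t) F) := by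
  induction F using MvPolynomial.induction_on with
  | C a => simp
  | add p q hp hq => simp [hp, hq]
  | mul_X p e hp => simp [hp, ev]

/-- The evaluations at any parameter of a `𝕜[X]`-basis of `ι → 𝕜[X]` are linearly independent over `𝕜`
(the coordinate matrix is invertible over `𝕜[X]`, hence so is its evaluation). -/
theorem linearIndependent_ev_basis [Fintype ι] [DecidableEq ι] (b : Module.Basis ι 𝕜[X] (ι → 𝕜[X])) (t : 𝕜) :
    LinearIndependent 𝕜 (fun j => ev t (b j)) := by
  set A : Matrix ι ι 𝕜[X] := (Pi.basisFun 𝕜[X] ι).toMatrix b with hA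
  set B : Matrix ι ι 𝕜[X] := b.toMatrix (Pi.basisFun 𝕜[X] ι) with hB
  have hBA : B * A = 1 := Module.Basis.toMatrix_mul_toMatrix_flip _ _
  have hA' : ∀ i j, A i j = b j i := by
    intro i j; simp [hA, Module.Basis.toMatrix_apply, Pi.basisFun_repr]
  have h1 : B.map (Polynomial.evalRingHom t) * A.map (Polynomial.evalRingHom t) = 1 := by
    rw [← Matrix.map_mul, hBA, Matrix.map_one _ (map_zero _) (map_one _)]
  rw [Fintype.linearIndependent_iff]
  intro g hg j
  have hmv : (A.map (Polynomial.evalRingHom t)).mulVec g = 0 := by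
    funext i
    have := congrFun hg i
    simp only [Finset.sum_apply, Pi.smul_apply, smul_eq_mul, Pi.zero_apply, ev_apply] at this
    simp only [Matrix.mulVec, dotProduct, Matrix.map_apply, Polynomial.coe_evalRingHom, hA', Pi.zero_apply]
    rw [← this]
    exact Finset.sum_congr rfl fun j _ => mul_comm _ _
  have hg' : g = (B.map (Polynomial.evalRingHom t) * A.map (Polynomial.evalRingHom t)).mulVec g := by
    rw [h1, Matrix.one_mulVec]
  rw [hg', ← Matrix.mulVec_mulVec, hmv, Matrix.mulVec_zero, Pi.zero_apply]

/-- INITIAL VECTORS LIE IN THE LIMIT ZERO LOCUS.  If `X^C • u ∈ N` and every evaluation `ev t p` (`p ∈ N`, `t ∈ T`,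
`T` infinite and missing `0`) is a zero of the evaluated family, then `ev 0 u` is a zero of the family evaluated at `0`. -/
theorem eval_ev_zero_of_initial (N : Submodule 𝕜[X] (ι → 𝕜[X])) (𝓕 : Set (MvPolynomial ι 𝕜[X]))
    (T : Set 𝕜) (hT : T.Infinite) (hT0 : (0 : 𝕜) ∉ T)
    (hS : ∀ t ∈ T, ∀ p ∈ N, ∀ F ∈ 𝓕, MvPolynomial.eval (ev t p) (MvPolynomial.map (Polynomial.evalRingHom t) F) = 0)
    {u : ι → 𝕜[X]} {C : ℕ} (hu : ((Polynomial.X : 𝕜[X]) ^ C) • u ∈ N) {F : MvPolynomial ι 𝕜[X]} (hF : F ∈ 𝓕) :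
    MvPolynomial.eval (ev 0 u) (MvPolynomial.map (Polynomial.evalRingHom 0) F) = 0 := by
  -- the polynomial `t ↦ F_t(u(t))` vanishes on `T`
  set Φ : 𝕜[X] := MvPolynomial.eval u F with hΦ
  have hroot : ∀ t ∈ T, Φ.IsRoot t := by
    intro t ht
    have ht0 : t ≠ 0 := fun h => hT0 (h ▸ ht)
    have hmem : (t⁻¹) ^ C • (((Polynomial.X : 𝕜[X]) ^ C) • u) ∈ N := N.smul_of_tower_mem _ hu
    have hev : ev t ((t⁻¹) ^ C • (((Polynomial.X : 𝕜[X]) ^ C) • u)) = ev t u := by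
      rw [ev_smul, ev_smul_poly, Polynomial.eval_pow, Polynomial.eval_X, smul_smul, ← mul_pow,
        inv_mul_cancel₀ ht0, one_pow, one_smul]
    have := hS t ht _ hmem F hF
    rw [hev, ← eval_ev] at this
    exact this
  have hΦ0 : Φ = 0 := Polynomial.eq_zero_of_infinite_isRoot Φ (hT.mono fun t ht => hroot t ht)
  have := congrArg (Polynomial.eval (0 : 𝕜)) hΦ0
  rw [Polynomial.eval_zero, hΦ, eval_ev] at this
  exact this

/-- **CURVE CLOSURE (algebraic families).**  Let `N ≤ (ι → 𝕜[X])` be a `𝕜[X]`-submodule — an ALGEBRAIC one-parameter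
family of certificate vectors — such that for every parameter `t` in an infinite set `T ∌ 0` all evaluations `ev t p`,
`p ∈ N`, lie in the zero locus of the family `𝓕` evaluated at `t`.  Then there is a `𝕜`-subspace `K₀` of the SAME dimension
(`finrank 𝕜 K₀ = finrank 𝕜[X] N`, the generic dimension of the family) consisting of INITIAL VECTORS of `N`
(`v = u(0)` with `X^C u ∈ N`) and contained in the zero locus of `𝓕` evaluated at `t = 0`.
Proof: Smith normal form of `N` over the PID `𝕜[X]` (aligned bases `bN i = a i • bM (f i)`), `a i = X^{c i} g i` with
`g i (0) ≠ 0`, `K₀ := span (ev 0 (bM (f i)))` (independent: `linearIndependent_ev_basis`), and `eval_ev_zero_of_initial`. -/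
theorem exists_limit_of_algebraic_family [Fintype ι] [DecidableEq ι] (N : Submodule 𝕜[X] (ι → 𝕜[X]))
    (𝓕 : Set (MvPolynomial ι 𝕜[X])) (T : Set 𝕜) (hT : T.Infinite) (hT0 : (0 : 𝕜) ∉ T)
    (hS : ∀ t ∈ T, ∀ p ∈ N, ∀ F ∈ 𝓕, MvPolynomial.eval (ev t p) (MvPolynomial.map (Polynomial.evalRingHom t) F) = 0) :
    ∃ K₀ : Submodule 𝕜 (ι → 𝕜), Module.finrank 𝕜 K₀ = Module.finrank 𝕜[X] N ∧
      (∀ v ∈ K₀, ∃ u : ι → 𝕜[X], ev 0 u = v ∧ ∃ C : ℕ, ((Polynomial.X : 𝕜[X]) ^ C) • u ∈ N) ∧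
      ∀ v ∈ K₀, ∀ F ∈ 𝓕, MvPolynomial.eval v (MvPolynomial.map (Polynomial.evalRingHom 0) F) = 0 := by
  obtain ⟨n, bM, bN, f, a, hsnf⟩ := Submodule.smithNormalForm (Pi.basisFun 𝕜[X] ι) N
  -- the diagonal entries are nonzero
  have ha : ∀ i, a i ≠ 0 := by
    intro i h
    have h1 : (bN i : ι → 𝕜[X]) = 0 := by rw [hsnf i, h, zero_smul]
    exact bN.ne_zero i (Subtype.coe_injective.eq_iff.mp (h1.trans (Submodule.coe_zero).symm))
  -- `a i = X^{c i} * g i` with `g i (0) ≠ 0`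
  have hdec : ∀ i, ∃ q : 𝕜[X], a i = (Polynomial.X) ^ (a i).rootMultiplicity 0 * q ∧ q.eval 0 ≠ 0 := by
    intro i
    obtain ⟨q, hq, hndvd⟩ := Polynomial.exists_eq_pow_rootMultiplicity_mul_and_not_dvd (a i) (ha i) 0
    rw [map_zero, sub_zero] at hq hndvd
    refine ⟨q, hq, fun h0 => hndvd ?_⟩
    rw [Polynomial.X_dvd_iff, Polynomial.coeff_zero_eq_eval_zero]
    exact h0
  choose g hg using hdec
  set c : Fin n → ℕ := fun i => (a i).rootMultiplicity 0 with hc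
  -- the limit subspace
  set e : Fin n → ι → 𝕜 := fun i => ev 0 (bM (f i)) with he
  have hind : LinearIndependent 𝕜 e := (linearIndependent_ev_basis bM 0).comp f f.injective
  refine ⟨Submodule.span 𝕜 (Set.range e), ?_, ?_, ?_⟩
  · rw [finrank_span_eq_card hind, Fintype.card_fin, Module.finrank_eq_card_basis bN, Fintype.card_fin]
  · intro v hv
    obtain ⟨lam, rfl⟩ := Submodule.mem_span_range_iff_exists_fun 𝕜 |>.mp hv
    -- u := Σ (lam i / g i 0) • g i • bM (f i), and X^{Cmax} u ∈ N
    let Cmax : ℕ := ∑ i, c i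
    have hcle : ∀ i, c i ≤ Cmax := fun i => Finset.single_le_sum (fun j _ => Nat.zero_le (c j)) (Finset.mem_univ i)
    refine ⟨∑ i, (lam i / (g i).eval 0) • (g i • bM (f i)), ?_, Cmax, ?_⟩
    · rw [ev_sum]
      refine Finset.sum_congr rfl fun i _ => ?_
      rw [ev_smul, ev_smul_poly, smul_smul, div_mul_cancel₀ _ (hg i).2]
    · rw [Finset.smul_sum]
      refine Submodule.sum_mem _ fun i _ => ?_
      have hterm : ((Polynomial.X : 𝕜[X]) ^ Cmax) • ((lam i / (g i).eval 0) • (g i • bM (f i)))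
          = (lam i / (g i).eval 0) • ((Polynomial.X : 𝕜[X]) ^ (Cmax - c i) • (bN i : ι → 𝕜[X])) := by
        rw [hsnf i, (hg i).1, smul_comm, smul_smul, smul_smul, ← mul_assoc, pow_sub_mul_pow _ (hcle i)]
      rw [hterm]
      exact Submodule.smul_of_tower_mem _ _ (N.smul_mem _ (bN i).2)
  · intro v hv F hF
    -- reuse the previous bullet through `eval_ev_zero_of_initial`
    obtain ⟨lam, rfl⟩ := Submodule.mem_span_range_iff_exists_fun 𝕜 |>.mp hv
    let Cmax : ℕ := ∑ i, c i
    have hcle : ∀ i, c i ≤ Cmax := fun i => Finset.single_le_sum (fun j _ => Nat.zero_le (c j)) (Finset.mem_univ i)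
    set u : ι → 𝕜[X] := ∑ i, (lam i / (g i).eval 0) • (g i • bM (f i)) with hu_def
    have hu0 : ev 0 u = ∑ i, lam i • e i := by
      rw [hu_def, ev_sum]
      refine Finset.sum_congr rfl fun i _ => ?_
      rw [ev_smul, ev_smul_poly, smul_smul, div_mul_cancel₀ _ (hg i).2]
    have huN : ((Polynomial.X : 𝕜[X]) ^ Cmax) • u ∈ N := by
      rw [hu_def, Finset.smul_sum]
      refine Submodule.sum_mem _ fun i _ => ?_
      have hterm : ((Polynomial.X : 𝕜[X]) ^ Cmax) • ((lam i / (g i).eval 0) • (g i • bM (f i)))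
          = (lam i / (g i).eval 0) • ((Polynomial.X : 𝕜[X]) ^ (Cmax - c i) • (bN i : ι → 𝕜[X])) := by
        rw [hsnf i, (hg i).1, smul_comm, smul_smul, smul_smul, ← mul_assoc, pow_sub_mul_pow _ (hcle i)]
      rw [hterm]
      exact Submodule.smul_of_tower_mem _ _ (N.smul_mem _ (bN i).2)
    rw [← hu0]
    exact eval_ev_zero_of_initial N 𝓕 T hT hT0 hS huN hF

/-- **CURVE CLOSURE, canonical form (Part III′).**  As `exists_limit_of_algebraic_family`, with the limit subspace characterised
SEMANTICALLY: every polynomial vector `w` whose evaluations lie in the evaluated family for infinitely many parameters has its initial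
vector `ev 0 w` in `K₀` (so `K₀` is the space of ALL initial vectors — the canonical limit). -/
theorem exists_limit_of_algebraic_family' [Fintype ι] [DecidableEq ι] (N : Submodule 𝕜[X] (ι → 𝕜[X]))
    (𝓕 : Set (MvPolynomial ι 𝕜[X])) (T : Set 𝕜) (hT : T.Infinite) (hT0 : (0 : 𝕜) ∉ T)
    (hS : ∀ t ∈ T, ∀ p ∈ N, ∀ F ∈ 𝓕, MvPolynomial.eval (ev t p) (MvPolynomial.map (Polynomial.evalRingHom t) F) = 0) :
    ∃ K₀ : Submodule 𝕜 (ι → 𝕜), Module.finrank 𝕜 K₀ = Module.finrank 𝕜[X] N ∧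
      (∀ v ∈ K₀, ∃ u : ι → 𝕜[X], ev 0 u = v ∧ ∃ C : ℕ, ((Polynomial.X : 𝕜[X]) ^ C) • u ∈ N) ∧
      (∀ w : ι → 𝕜[X], Set.Infinite {t : 𝕜 | ∃ p ∈ N, ev t p = ev t w} → ev 0 w ∈ K₀) ∧
      ∀ v ∈ K₀, ∀ F ∈ 𝓕, MvPolynomial.eval v (MvPolynomial.map (Polynomial.evalRingHom 0) F) = 0 := by
  obtain ⟨n, bM, bN, f, a, hsnf⟩ := Submodule.smithNormalForm (Pi.basisFun 𝕜[X] ι) N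
  have ha : ∀ i, a i ≠ 0 := by
    intro i h
    have h1 : (bN i : ι → 𝕜[X]) = 0 := by rw [hsnf i, h, zero_smul]
    exact bN.ne_zero i (Subtype.coe_injective.eq_iff.mp (h1.trans (Submodule.coe_zero).symm))
  have hdec : ∀ i, ∃ q : 𝕜[X], a i = (Polynomial.X) ^ (a i).rootMultiplicity 0 * q ∧ q.eval 0 ≠ 0 := by
    intro i
    obtain ⟨q, hq, hndvd⟩ := Polynomial.exists_eq_pow_rootMultiplicity_mul_and_not_dvd (a i) (ha i) 0
    rw [map_zero, sub_zero] at hq hndvd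
    refine ⟨q, hq, fun h0 => hndvd ?_⟩
    rw [Polynomial.X_dvd_iff, Polynomial.coeff_zero_eq_eval_zero]
    exact h0
  choose g hg using hdec
  set c : Fin n → ℕ := fun i => (a i).rootMultiplicity 0 with hc
  set e : Fin n → ι → 𝕜 := fun i => ev 0 (bM (f i)) with he
  have hind : LinearIndependent 𝕜 e := (linearIndependent_ev_basis bM 0).comp f f.injective
  -- expansion of evaluations in the evaluated basis
  have hexp : ∀ (t : 𝕜) (w : ι → 𝕜[X]), ev t w = ∑ j, (bM.repr w j).eval t • ev t (bM j) := by
    intro t w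
    conv_lhs => rw [← bM.sum_repr w]
    rw [ev_sum]
    exact Finset.sum_congr rfl fun j _ => ev_smul_poly t _ _
  -- coordinates of members of `N` off `range f` vanish
  have hcoordN : ∀ p ∈ N, ∀ j, j ∉ Set.range f → bM.repr p j = 0 := by
    intro p hp j hj
    have h1 : p = ∑ i, bN.repr ⟨p, hp⟩ i • (bN i : ι → 𝕜[X]) := by
      have := congrArg Subtype.val (bN.sum_repr ⟨p, hp⟩)
      simp only [AddSubmonoidClass.coe_finsetSum, SetLike.val_smul] at this
      exact this.symm
    rw [h1, map_sum, Finsupp.finsetSum_apply]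
    refine Finset.sum_eq_zero fun i _ => ?_
    rw [map_smul, hsnf i, map_smul, bM.repr_self, Finsupp.smul_apply, Finsupp.smul_apply, Finsupp.single_apply,
      if_neg (fun h => hj ⟨i, h⟩), smul_zero, smul_zero]
  refine ⟨Submodule.span 𝕜 (Set.range e), ?_, ?_, ?_, ?_⟩
  · rw [finrank_span_eq_card hind, Fintype.card_fin, Module.finrank_eq_card_basis bN, Fintype.card_fin]
  · intro v hv
    obtain ⟨lam, rfl⟩ := Submodule.mem_span_range_iff_exists_fun 𝕜 |>.mp hv
    let Cmax : ℕ := ∑ i, c i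
    have hcle : ∀ i, c i ≤ Cmax := fun i => Finset.single_le_sum (fun j _ => Nat.zero_le (c j)) (Finset.mem_univ i)
    refine ⟨∑ i, (lam i / (g i).eval 0) • (g i • bM (f i)), ?_, Cmax, ?_⟩
    · rw [ev_sum]
      refine Finset.sum_congr rfl fun i _ => ?_
      rw [ev_smul, ev_smul_poly, smul_smul, div_mul_cancel₀ _ (hg i).2]
    · rw [Finset.smul_sum]
      refine Submodule.sum_mem _ fun i _ => ?_
      have hterm : ((Polynomial.X : 𝕜[X]) ^ Cmax) • ((lam i / (g i).eval 0) • (g i • bM (f i)))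
          = (lam i / (g i).eval 0) • ((Polynomial.X : 𝕜[X]) ^ (Cmax - c i) • (bN i : ι → 𝕜[X])) := by
        rw [hsnf i, (hg i).1, smul_comm, smul_smul, smul_smul, ← mul_assoc, pow_sub_mul_pow _ (hcle i)]
      rw [hterm]
      exact Submodule.smul_of_tower_mem _ _ (N.smul_mem _ (bN i).2)
  · -- the canonical-limit property
    intro w hw
    have hvan : ∀ j, j ∉ Set.range f → bM.repr w j = 0 := by
      intro j hj
      apply Polynomial.eq_zero_of_infinite_isRoot
      refine hw.mono ?_
      rintro t ⟨p, hp, hpt⟩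
      have h1 := hexp t p
      have h2 := hexp t w
      rw [hpt] at h1
      have h3 : ∑ j, ((bM.repr p j).eval t - (bM.repr w j).eval t) • ev t (bM j) = 0 := by
        simp only [sub_smul, Finset.sum_sub_distrib, ← h1, ← h2, sub_self]
      have h4 := Fintype.linearIndependent_iff.mp (linearIndependent_ev_basis bM t) _ h3 j
      rw [hcoordN p hp j hj, Polynomial.eval_zero, zero_sub, neg_eq_zero] at h4
      exact h4
    have hw0 : ev 0 w = ∑ i, (bM.repr w (f i)).eval 0 • e i := by
      rw [hexp 0 w]
      rw [← Finset.sum_subset (Finset.subset_univ (Finset.univ.map f))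
        (fun j _ hj => by
          rw [hvan j (fun ⟨i, hi⟩ => hj (Finset.mem_map.mpr ⟨i, Finset.mem_univ _, hi⟩)), Polynomial.eval_zero, zero_smul])]
      rw [Finset.sum_map]
    rw [hw0]
    exact Submodule.sum_mem _ fun i _ => Submodule.smul_mem _ _ (Submodule.subset_span ⟨i, rfl⟩)
  · intro v hv F hF
    obtain ⟨lam, rfl⟩ := Submodule.mem_span_range_iff_exists_fun 𝕜 |>.mp hv
    let Cmax : ℕ := ∑ i, c i
    have hcle : ∀ i, c i ≤ Cmax := fun i => Finset.single_le_sum (fun j _ => Nat.zero_le (c j)) (Finset.mem_univ i)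
    set u : ι → 𝕜[X] := ∑ i, (lam i / (g i).eval 0) • (g i • bM (f i)) with hu_def
    have hu0 : ev 0 u = ∑ i, lam i • e i := by
      rw [hu_def, ev_sum]
      refine Finset.sum_congr rfl fun i _ => ?_
      rw [ev_smul, ev_smul_poly, smul_smul, div_mul_cancel₀ _ (hg i).2]
    have huN : ((Polynomial.X : 𝕜[X]) ^ Cmax) • u ∈ N := by
      rw [hu_def, Finset.smul_sum]
      refine Submodule.sum_mem _ fun i _ => ?_
      have hterm : ((Polynomial.X : 𝕜[X]) ^ Cmax) • ((lam i / (g i).eval 0) • (g i • bM (f i)))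
          = (lam i / (g i).eval 0) • ((Polynomial.X : 𝕜[X]) ^ (Cmax - c i) • (bN i : ι → 𝕜[X])) := by
        rw [hsnf i, (hg i).1, smul_comm, smul_smul, smul_smul, ← mul_assoc, pow_sub_mul_pow _ (hcle i)]
      rw [hterm]
      exact Submodule.smul_of_tower_mem _ _ (N.smul_mem _ (bN i).2)
    rw [← hu0]
    exact eval_ev_zero_of_initial N 𝓕 T hT hT0 hS huN hF

end Summit.ValiantsHypothesis.ValiantsHypothesis.Theorems.GrenetZeon.InitialForm.CurveClosure

end CurveClosure
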